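import Mathlib
import Summits.RiemannHypothesis.RiemannHypothesis.Theorems.SignConeConeMagnificationDesignGcdForm
import Summits.RiemannHypothesis.RiemannHypothesis.Theorems.SignConeConeMagnificationDesignBlocks

/-!
# Crux `SignCone.ConeMagnification` (stmt-RiemannHypothesis-16303), line `Sketch` r8, stub `stub_designOfTypes`:
# the normalised gcd-form profiles of the two composite designs

Seat-0 programme for the open core `stub_designOfTypes` (design algebra §1, composite level).  With the
factorisation `SignConeConeMagnificationDesignGcdForm` and the single-prime blocks
`SignConeConeMagnificationDesignBlocks`, the two families of designs used by the proof have explicit gcd forms: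

* `gcdForm_firstOrderDesign` — FIRST-ORDER PRODUCT DESIGNS: for a finite set `S` of primes and prescribed ratios
  `ρ_p ∈ [1 − (√p+1)/2, 1 + (√p−1)/2]` there is a finitely supported `α` with
  `Φ_α(n) = K · Π_{p ∈ S, p ∣ n} ρ_p` (`K > 0`, all `n ≥ 1`).  Used with `ρ ≡ 6/5` (Step 1) and `ρ = 1 ± τ_p` (AX-B).
* `gcdForm_killerDesign` — KILLER/EXCLUDER DESIGNS: for finite sets of primes `D ⊆ Q`, moduli `m_p ∈ [0, √p/2]`
  (`p ∈ D`) and a unit complex number `ω` there is a finitely supported `α` with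
  `Φ_α(n) = K · 𝟙[q ∤ n ∀ q ∈ Q∖D] · 𝟙[p² ∤ n ∀ p ∈ D] · (Π_{p∈D, p∣n} m_p) · ω^{#{p∈D : p∣n}}` (`K > 0`).
  Used with `m_p = √p/2`, `ω = −e^{iφ}`, `Q` = primes `≤ z` (deficit extraction) and with `Q = D = S`,
  `m_p = √p a_p/2`, `ω = e^{iφ}` (AX-C: this is literally the Riesz–Euler profile of the landed spine).
-/

noncomputable section

-- `Summit.RiemannHypothesis.RiemannHypothesis.…` repeats a namespace component by design (D-0017 layout).
set_option linter.dupNamespace false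

open Finset
open scoped BigOperators ComplexConjugate

namespace Summit.RiemannHypothesis.RiemannHypothesis.Theorems.SignConeConeMagnification

namespace Design

/-! ### Divisibility through the factorisation -/

/-- `v_p(n) = 0 ↔ p ∤ n` (`n ≠ 0`). [folklore] -/
theorem factorization_eq_zero_iff_not_dvd {p n : ℕ} (hp : p.Prime) (hn : n ≠ 0) :
    n.factorization p = 0 ↔ ¬ p ∣ n := by
  rw [hp.dvd_iff_one_le_factorization hn]
  omega

/-- `1 ≤ v_p(n) ↔ p ∣ n` (`n ≠ 0`). [folklore] -/
theorem one_le_factorization_iff_dvd {p n : ℕ} (hp : p.Prime) (hn : n ≠ 0) :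
    1 ≤ n.factorization p ↔ p ∣ n :=
  (hp.dvd_iff_one_le_factorization hn).symm

/-- `2 ≤ v_p(n) ↔ p² ∣ n` (`n ≠ 0`). [folklore] -/
theorem two_le_factorization_iff_sq_dvd {p n : ℕ} (hp : p.Prime) (hn : n ≠ 0) :
    2 ≤ n.factorization p ↔ p ^ 2 ∣ n :=
  (hp.pow_dvd_iff_le_factorization hn).symm

/-! ### First-order product designs -/

/-- **gcd form of a first-order product design.**  For a finite set `S` of primes and ratios
`ρ_p ∈ [1 − (√p+1)/2, 1 + (√p−1)/2]` (`p ∈ S`) there is a finitely supported design `α` (blocks `(1−x_p, √p x_p, 0)`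
with `ρ(x_p) = ρ_p`) whose gcd form is `K · Π_{p∈S, p∣n} ρ_p` for all `n ≥ 1`, with `K = Π_p (1+(p−1)x_p²) > 0`. [folklore] -/
theorem gcdForm_firstOrderDesign (S : Finset ℕ) (hS : ∀ p ∈ S, p.Prime) (ρ : ℕ → ℝ)
    (hρ : ∀ p ∈ S, 1 - (Real.sqrt p + 1) / 2 ≤ ρ p ∧ ρ p ≤ 1 + (Real.sqrt p - 1) / 2) :
    ∃ α : ℕ → ℂ, ∃ L : ℕ, ∃ K : ℝ, 0 < K ∧ (∀ m, L < m → α m = 0) ∧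
      ∀ n : ℕ, n ≠ 0 →
        (∑ ℓ ∈ Finset.Icc 1 L, ∑ ℓ' ∈ Finset.Icc 1 L, α ℓ * (starRingEnd ℂ) (α ℓ') *
            (((Nat.gcd (n * ℓ') ℓ : ℕ) : ℝ) : ℂ) / (Real.sqrt ((ℓ : ℝ) * ℓ') : ℂ)) =
          ((K * ∏ p ∈ S.filter (· ∣ n), ρ p : ℝ) : ℂ) := by
  classical
  -- choose the block parameters
  have hex : ∀ p : ℕ, ∃ x : ℝ, p ∈ S →
      (1 + ((p : ℝ) - 1) * x) / (1 + ((p : ℝ) - 1) * x ^ 2) = ρ p := by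
    intro p
    by_cases hp : p ∈ S
    · obtain ⟨x, hx⟩ := exists_firstRatio_eq p (hS p hp) (ρ p) (hρ p hp).1 (hρ p hp).2
      exact ⟨x, fun _ => hx⟩
    · exact ⟨0, fun h => absurd h hp⟩
  choose x hx using hex
  -- the blocks and the design
  set f : ℕ → ℕ → ℂ := fun p i =>
    if i = 0 then (((1 - x p : ℝ)) : ℂ) else if i = 1 then (((Real.sqrt p * x p : ℝ)) : ℂ) else 0 with hf
  set L : ℕ := ∏ p ∈ S, p ^ 2 with hL
  set α : ℕ → ℂ := fun ℓ => ∑ y ∈ (Fintype.piFinset fun _ : S => Finset.range 3) with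
      (∏ i : S, (i : ℕ) ^ y i) = ℓ, ∏ i : S, f i (y i) with hαdef
  have hα : ∀ ℓ, α ℓ = ∑ y ∈ (Fintype.piFinset fun _ : S => Finset.range 3) with
      (∏ i : S, (i : ℕ) ^ y i) = ℓ, ∏ i : S, f i (y i) := fun ℓ => rfl
  have hden : ∀ p ∈ S, 0 < 1 + ((p : ℝ) - 1) * x p ^ 2 := by
    intro p hp
    have hp1 : (1 : ℝ) ≤ p := by exact_mod_cast (hS p hp).one_lt.le
    have : 0 ≤ ((p : ℝ) - 1) * x p ^ 2 := mul_nonneg (by linarith) (sq_nonneg _)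
    linarith
  refine ⟨α, L, ∏ p ∈ S, (1 + ((p : ℝ) - 1) * x p ^ 2), Finset.prod_pos hden,
    blockDesign_eq_zero_of_lt S hS f α hα L le_rfl, fun n hn => ?_⟩
  rw [gcdForm_blockDesign S hS f α hα L le_rfl n hn, Complex.ofReal_mul, Complex.ofReal_prod,
    Complex.ofReal_prod, Finset.prod_filter, ← Finset.prod_mul_distrib]
  refine Finset.prod_congr rfl fun p hp => ?_
  have hpP := hS p hp
  have hf0 : f p 0 = ((1 - x p : ℝ) : ℂ) := by simp [hf]
  have hf1 : f p 1 = ((Real.sqrt p * x p : ℝ) : ℂ) := by simp [hf]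
  have hf2 : f p 2 = 0 := by simp [hf]
  by_cases hdvd : p ∣ n
  · have hv : 1 ≤ n.factorization p := (one_le_factorization_iff_dvd hpP hn).2 hdvd
    rw [if_pos hdvd, blockForm_first_pos p hpP (x p) (f p) hf0 hf1 hf2 _ hv]
    have hxp := hx p hp
    rw [div_eq_iff (hden p hp).ne'] at hxp
    rw [hxp, Complex.ofReal_mul, mul_comm]
  · have hv : n.factorization p = 0 := (factorization_eq_zero_iff_not_dvd hpP hn).2 hdvd
    rw [if_neg hdvd, mul_one, hv, blockForm_first_zero p hpP (x p) (f p) hf0 hf1 hf2]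

/-! ### Killer/excluder designs -/

/-- **gcd form of a killer/excluder design.**  For finite sets of primes `D ⊆ Q`, moduli `m_p ∈ [0, √p/2]` (`p ∈ D`)
and a unit complex number `ω` (`ω̄ = ω⁻¹`) there is a finitely supported design `α` (squarefree-killer blocks
`K(t_p, ω)` with `p t_p/(t_p²+p) = m_p` at `p ∈ D`, excluder blocks at `q ∈ Q ∖ D`) whose gcd form is, for `n ≥ 1`,
`K · 𝟙[q ∤ n, q ∈ Q∖D] · 𝟙[p² ∤ n, p ∈ D] · (Π_{p∈D, p∣n} m_p) · ω^{#{p ∈ D : p ∣ n}}` with `K > 0`. [folklore] -/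
theorem gcdForm_killerDesign (Q D : Finset ℕ) (hQ : ∀ p ∈ Q, p.Prime) (hDQ : D ⊆ Q) (m : ℕ → ℝ)
    (hm : ∀ p ∈ D, 0 ≤ m p ∧ m p ≤ Real.sqrt p / 2) (ω : ℂ) (hω0 : ω ≠ 0)
    (hω : (starRingEnd ℂ) ω = ω⁻¹) :
    ∃ α : ℕ → ℂ, ∃ L : ℕ, ∃ K : ℝ, 0 < K ∧ (∀ m', L < m' → α m' = 0) ∧
      ∀ n : ℕ, n ≠ 0 →
        (∑ ℓ ∈ Finset.Icc 1 L, ∑ ℓ' ∈ Finset.Icc 1 L, α ℓ * (starRingEnd ℂ) (α ℓ') *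
            (((Nat.gcd (n * ℓ') ℓ : ℕ) : ℝ) : ℂ) / (Real.sqrt ((ℓ : ℝ) * ℓ') : ℂ)) =
          (K : ℂ) * (if (∀ q ∈ Q \ D, ¬ q ∣ n) ∧ (∀ p ∈ D, ¬ p ^ 2 ∣ n) then
            (∏ p ∈ D.filter (· ∣ n), ((m p : ℝ) : ℂ)) * ω ^ (D.filter (· ∣ n)).card else 0) := by
  classical
  have hD : ∀ p ∈ D, p.Prime := fun p hp => hQ p (hDQ hp)
  -- choose the killer parameters
  have hex : ∀ p : ℕ, ∃ t : ℝ, p ∈ D → 0 ≤ t ∧ (p : ℝ) * t / (t ^ 2 + p) = m p := by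
    intro p
    by_cases hp : p ∈ D
    · obtain ⟨t, ht0, ht⟩ := exists_killerRatio_eq p (hD p hp) (m p) (hm p hp).1 (hm p hp).2
      exact ⟨t, fun _ => ⟨ht0, ht⟩⟩
    · exact ⟨0, fun h => absurd h hp⟩
  choose t ht using hex
  -- the blocks and the design
  set f : ℕ → ℕ → ℂ := fun p i =>
    if p ∈ D then
      (if i = 0 then -(t p : ℂ) * (starRingEnd ℂ) ω
        else if i = 1 then ((Real.sqrt p : ℝ) : ℂ) * ((t p : ℂ) * (starRingEnd ℂ) ω - 1) else (p : ℂ))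
    else (if i = 0 then 0 else if i = 1 then -((Real.sqrt p : ℝ) : ℂ) else (p : ℂ)) with hf
  set L : ℕ := ∏ p ∈ Q, p ^ 2 with hL
  set α : ℕ → ℂ := fun ℓ => ∑ y ∈ (Fintype.piFinset fun _ : Q => Finset.range 3) with
      (∏ i : Q, (i : ℕ) ^ y i) = ℓ, ∏ i : Q, f i (y i) with hαdef
  have hα : ∀ ℓ, α ℓ = ∑ y ∈ (Fintype.piFinset fun _ : Q => Finset.range 3) with
      (∏ i : Q, (i : ℕ) ^ y i) = ℓ, ∏ i : Q, f i (y i) := fun ℓ => rfl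
  -- the normalising constant
  set Kp : ℕ → ℝ := fun p => if p ∈ D then ((p : ℝ) - 1) * (t p ^ 2 + p) else (p : ℝ) * ((p : ℝ) - 1)
    with hKp
  have hKpos : ∀ p ∈ Q, 0 < Kp p := by
    intro p hp
    have h2 : (2 : ℝ) ≤ p := by exact_mod_cast (hQ p hp).two_le
    simp only [hKp]
    split_ifs
    · exact mul_pos (by linarith) (by positivity)
    · exact mul_pos (by linarith) (by linarith)
  refine ⟨α, L, ∏ p ∈ Q, Kp p, Finset.prod_pos hKpos, blockDesign_eq_zero_of_lt Q hQ f α hα L le_rfl,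
    fun n hn => ?_⟩
  rw [gcdForm_blockDesign Q hQ f α hα L le_rfl n hn]
  -- block values
  have hfD0 : ∀ p ∈ D, f p 0 = -(t p : ℂ) * (starRingEnd ℂ) ω := fun p hp => by simp [hf, hp]
  have hfD1 : ∀ p ∈ D, f p 1 = ((Real.sqrt p : ℝ) : ℂ) * ((t p : ℂ) * (starRingEnd ℂ) ω - 1) :=
    fun p hp => by simp [hf, hp]
  have hfD2 : ∀ p ∈ D, f p 2 = (p : ℂ) := fun p hp => by simp [hf, hp]
  have hfE0 : ∀ p, p ∉ D → f p 0 = 0 := fun p hp => by simp [hf, hp]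
  have hfE1 : ∀ p, p ∉ D → f p 1 = -((Real.sqrt p : ℝ) : ℂ) := fun p hp => by simp [hf, hp]
  have hfE2 : ∀ p, p ∉ D → f p 2 = (p : ℂ) := fun p hp => by simp [hf, hp]
  by_cases hA : ∃ q ∈ Q \ D, q ∣ n
  · -- an excluded prime divides `n`: both sides vanish
    obtain ⟨q, hq, hqn⟩ := hA
    have hqQ : q ∈ Q := (Finset.mem_sdiff.1 hq).1
    have hqD : q ∉ D := (Finset.mem_sdiff.1 hq).2
    have hcond : ¬ ((∀ q ∈ Q \ D, ¬ q ∣ n) ∧ (∀ p ∈ D, ¬ p ^ 2 ∣ n)) := fun h => h.1 q hq hqn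
    rw [if_neg hcond, mul_zero]
    apply Finset.prod_eq_zero hqQ
    exact blockForm_excluder_pos q (hQ q hqQ) (f q) (hfE0 q hqD) (hfE1 q hqD) (hfE2 q hqD) _
      ((one_le_factorization_iff_dvd (hQ q hqQ) hn).2 hqn)
  by_cases hB : ∃ p ∈ D, p ^ 2 ∣ n
  · -- a killed square divides `n`: both sides vanish
    obtain ⟨p, hp, hpn⟩ := hB
    have hcond : ¬ ((∀ q ∈ Q \ D, ¬ q ∣ n) ∧ (∀ p ∈ D, ¬ p ^ 2 ∣ n)) := fun h => h.2 p hp hpn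
    rw [if_neg hcond, mul_zero]
    apply Finset.prod_eq_zero (hDQ hp)
    exact blockForm_killer_two p (hD p hp) (t p) ω hω0 hω (f p) (hfD0 p hp) (hfD1 p hp) (hfD2 p hp) _
      ((two_le_factorization_iff_sq_dvd (hD p hp) hn).2 hpn)
  -- the surviving case
  push Not at hA hB
  rw [if_pos ⟨hA, hB⟩]
  have hsplit : ∀ p ∈ Q, (∑ i ∈ Finset.range 3, ∑ j ∈ Finset.range 3, f p i * (starRingEnd ℂ) (f p j) *
      ((p : ℂ) ^ min i (j + n.factorization p) / (Real.sqrt ((p : ℝ) ^ i * (p : ℝ) ^ j) : ℂ))) =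
      ((Kp p : ℝ) : ℂ) * (if p ∈ D ∧ p ∣ n then ((m p : ℝ) : ℂ) * ω else 1) := by
    intro p hp
    have hpP := hQ p hp
    by_cases hpD : p ∈ D
    · have hKp' : Kp p = ((p : ℝ) - 1) * (t p ^ 2 + p) := by simp [hKp, hpD]
      by_cases hdvd : p ∣ n
      · -- exactly divisible
        have hv1 : 1 ≤ n.factorization p := (one_le_factorization_iff_dvd hpP hn).2 hdvd
        have hv2 : ¬ 2 ≤ n.factorization p := fun h => hB p hpD ((two_le_factorization_iff_sq_dvd hpP hn).1 h)
        have hv : n.factorization p = 1 := by omega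
        rw [hv, blockForm_killer_one p hpP (t p) ω hω0 hω (f p) (hfD0 p hpD) (hfD1 p hpD) (hfD2 p hpD),
          if_pos ⟨hpD, hdvd⟩, hKp', ← (ht p hpD).2]
        have hden : (t p : ℂ) ^ 2 + p ≠ 0 := by
          have : (0 : ℝ) < t p ^ 2 + p := by
            have : (0 : ℝ) < p := by exact_mod_cast hpP.pos
            positivity
          exact_mod_cast this.ne'
        push_cast
        field_simp
      · have hv : n.factorization p = 0 := (factorization_eq_zero_iff_not_dvd hpP hn).2 hdvd
        rw [hv, blockForm_killer_zero p hpP (t p) ω hω0 hω (f p) (hfD0 p hpD) (hfD1 p hpD) (hfD2 p hpD),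
          if_neg (fun h => hdvd h.2), mul_one, hKp']
        push_cast
        ring
    · have hKp' : Kp p = (p : ℝ) * ((p : ℝ) - 1) := by simp [hKp, hpD]
      have hdvd : ¬ p ∣ n := hA p (Finset.mem_sdiff.2 ⟨hp, hpD⟩)
      have hv : n.factorization p = 0 := (factorization_eq_zero_iff_not_dvd hpP hn).2 hdvd
      rw [hv, blockForm_excluder_zero p hpP (f p) (hfE0 p hpD) (hfE1 p hpD) (hfE2 p hpD),
        if_neg (fun h => hpD h.1), mul_one, hKp']
      push_cast
      ring
  rw [Finset.prod_congr rfl hsplit, Finset.prod_mul_distrib, Complex.ofReal_prod]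
  congr 1
  -- the profile factor
  have h1 : (∏ p ∈ Q, (if p ∈ D ∧ p ∣ n then ((m p : ℝ) : ℂ) * ω else 1)) =
      ∏ p ∈ D, (if p ∣ n then ((m p : ℝ) : ℂ) * ω else 1) := by
    rw [← Finset.prod_sdiff hDQ]
    have h2 : (∏ p ∈ Q \ D, (if p ∈ D ∧ p ∣ n then ((m p : ℝ) : ℂ) * ω else 1)) = 1 :=
      Finset.prod_eq_one fun p hp => if_neg fun h => (Finset.mem_sdiff.1 hp).2 h.1
    rw [h2, one_mul]
    exact Finset.prod_congr rfl fun p hp => by simp [hp]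
  rw [h1, ← Finset.prod_filter, Finset.prod_mul_distrib, Finset.prod_const]

/-- **Registered sub-goal `designKillerProfile`** (seat-0 anchor of this file, design algebra §1 of the proof of
`stub_designOfTypes`): killer/excluder designs realise the profile
`K · 𝟙[q ∤ n, q ∈ Q∖D] · 𝟙[p² ∤ n, p ∈ D] · (Π_{p∈D, p∣n} m_p) · ω^{#{p∈D : p∣n}}` as a gcd form. [folklore] -/
theorem designKillerProfile : ∀ Q D : Finset ℕ, (∀ p ∈ Q, p.Prime) → D ⊆ Q → ∀ m : ℕ → ℝ,
    (∀ p ∈ D, 0 ≤ m p ∧ m p ≤ Real.sqrt p / 2) → ∀ ω : ℂ, ω ≠ 0 → (starRingEnd ℂ) ω = ω⁻¹ →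
    ∃ α : ℕ → ℂ, ∃ L : ℕ, ∃ K : ℝ, 0 < K ∧ (∀ m', L < m' → α m' = 0) ∧
      ∀ n : ℕ, n ≠ 0 →
        (∑ ℓ ∈ Finset.Icc 1 L, ∑ ℓ' ∈ Finset.Icc 1 L, α ℓ * (starRingEnd ℂ) (α ℓ') *
            (((Nat.gcd (n * ℓ') ℓ : ℕ) : ℝ) : ℂ) / (Real.sqrt ((ℓ : ℝ) * ℓ') : ℂ)) =
          (K : ℂ) * (if (∀ q ∈ Q \ D, ¬ q ∣ n) ∧ (∀ p ∈ D, ¬ p ^ 2 ∣ n) then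
            (∏ p ∈ D.filter (· ∣ n), ((m p : ℝ) : ℂ)) * ω ^ (D.filter (· ∣ n)).card else 0) :=
  fun Q D hQ hDQ m hm ω hω0 hω => gcdForm_killerDesign Q D hQ hDQ m hm ω hω0 hω

end Design

end Summit.RiemannHypothesis.RiemannHypothesis.Theorems.SignConeConeMagnification
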